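/-
Copyright (c) 2026 the pub-hodgecm-mathlib formalisation cell (harness21).  Prover seat hodgecm-mathlib-F0P3a-p07 (g15) ((Cnt2′) chair): «S3-ram» seeding wave
(LEAD F0P3a-plan (g13); (α) block-law keeper F0P3a-p06 (g16)), depth dictionary PART 5: «EVEN DISCRIMINANT DEPTH IS AT LEAST 4» (the `n = 1` corner of the A-even cells); 2026-09-02.
-/
import Literature.NumberTheory.Rogawski1990.DepthZeroKappaTransferTypeTwoRamifiedWSideLatticeCurrencyTop   -- ★ F0P3a-p05 (g18) part X: `ncard_selfDual_fixed_lev_pow_eq_zero_of_le_of_even_depth_ramified`; brings ★ `finite_selfDual_fixed_of_even_depth_ramified`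
import Literature.NumberTheory.Automorphic.UnitaryLatticeTreeAnisotropicAxisCount                       -- ★ (this lineage, g14): `map_sub_one_stdLattice_le_scaleLattice_iff`, `mapGL_stdLattice_eq_of_forall_v_sub_one_lt_one`
import Literature.NumberTheory.Automorphic.UnitaryLatticeTreeSelfDualTransitiveTwo                      -- ★ `isSelfDualLattice_stdLattice_two_of_v`
import Literature.NumberTheory.Automorphic.LocalUnitaryIntegralLevel                                    -- ★ `placeForm_antidiagOne`
import Literature.NumberTheory.Rogawski1990.UnitFundamentalLemmaInertFlickerFrame                        -- ★ `isUnit_two_integer_iff_valued_eq_one`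
import HarnessLib

/-!
# The ramified type-(2) transfer, depth dictionary PART 5: a 2-deep elliptic `U(Φ₂)`-block has EVEN discriminant depth `2n ≥ 4` (Rogawski 1990 §4.9; Labesse–Langlands 1979 §2)

Topic `NumberTheory/Rogawski1990`; namespace `Literature.NumberTheory.Rogawski1990`.  THEOREMS ONLY (no definition, no instance, no notation, no named fact, no `sorry`); kernel lane
`--supports stmt-HodgeConjecture-24833`.  Cell `pub/hodgecm-mathlib` (D-0151), crux H413; road «S3-ram» (count-neutral).  The (α) block-law cells of branch A-even (`m = N = 2n`)
are stated for all `n ≥ 1` (the J0diff binder `hn : 1 ≤ n`), but at `n = 1` the hyperbolic census text `stub_Zhyp_zero_even_A` reads `#A = (q+1)·Σ_(i<0) q^(2i) = 0`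
although the root `L₀` itself is counted: the case is VACUOUS, and THIS FILE says so in the J0diff's own binders — **`typeTwo_two_le_n_of_even_ram`: `hblk + hirr + hdisc (N = 2n)
+ (1 ≤ n) ⇒ 2 ≤ n`**.  Proof: if `n = 1` then ★ `ncard_selfDual_fixed_lev_pow_eq_zero_of_le_of_even_depth_ramified` (F0P3a-p05 (g18): no fixed self-dual W-lattice `B` has
`(g_w − 1)B ⊆ ϖ^D B` for `D ≥ 2n = 2`, granted `|½tr g_w − 1| ≤ |ϖ^2|`) is contradicted by `B := L₀ = 𝒪_w²`, which is self-dual (★ `isSelfDualLattice_stdLattice_two_of_v`), fixed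
(★ `mapGL_stdLattice_eq_of_forall_v_sub_one_lt_one`) and of level `ϖ²` by `hblk` (★ `map_sub_one_stdLattice_le_scaleLattice_iff`); the set is finite (★ `finite_selfDual_fixed_of_even_depth_ramified`).
(Residually: at a self-dual vertex the traceless part of a hyperbolic-unitary `g_w − ½tr` is anti-hermitian, hence NILPOTENT mod `ϖ`, so no self-dual vertex is balanced for even `N`
and the depth at `L₀` is `≤ N − 1`; 2-deepness forces `N − 1 ≥ 2`.)  So the A-even pens (p08 (g20) ∕ A-p16 (g33) ∕ p05 (g18) ∕ F0P3-p03 (g16)) may open their `n = mA + 1` cells with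
`obtain hn2 := typeTwo_two_le_n_of_even_ram …` and dismiss `mA = 0` by `omega`.
HONEST LABEL: HC_CM is proved only modulo the 2 remaining named inputs (hLiu418 24832, h413 24833) until rung 0 closes; unconditional local algebra at one place, count-neutral.

## References
* [Rogawski1990] J. D. Rogawski, *Automorphic Representations of Unitary Groups in Three Variables*, Ann. of Math. Stud. 123 (1990), §4.9 pp. 54–56, Lemma 4.9.3.
* [LabesseLanglands1979] J.-P. Labesse, R. P. Langlands, *L-indistinguishability for SL(2)*, Canad. J. Math. 31 (1979), §2 Lemma 2.1 p. 8.
* [Kottwitz1986] R. E. Kottwitz, *Base change for unit elements of Hecke algebras*, Compositio Math. 60 (1986), §3.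
-/

set_option autoImplicit false

noncomputable section

open NumberField IsDedekindDomain ValuativeRel Matrix Polynomial
open Literature.NumberTheory.Automorphic Literature.NumberTheory.Automorphic.UnitaryGroup Literature.NumberTheory.QuadraticForms
open Literature.NumberTheory.Automorphic.UnitaryLatticeTree Literature.NumberTheory.Automorphic.HermitianLattice
open scoped ValuativeRel MatrixGroups

namespace Literature.NumberTheory.Rogawski1990

section EvenMin

variable (L : Type) [Field L] [NumberField L] [IsCMField L] {v : HeightOneSpectrum (𝓞 ↥(maximalRealSubfield L))}
  (w : PlacesOver L v) (hw : IsCMField.complexConj L • w.1 = w.1)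

set_option maxHeartbeats 1600000 in
-- budget only: statement-heavy CM-place tokens (the W-side ★ head's binders).
include hw in
/-- **EVEN DISCRIMINANT DEPTH IS AT LEAST `4`**: for a type-(2) `γ_H = (g, u)` at a tame-ramified place with `g_w` 2-deep (`hblk`), `χ_{g,w}` without roots (`hirr`) and
`|tr² − 4det|_w = exp(−2·2n)`, `n ≥ 1`: **`2 ≤ n`** (the `n = 1` corner of the A-even block-law cells is vacuous).
[cite: Rogawski1990, §4.9 Lemma 4.9.3 p. 56] [cite: LabesseLanglands1979, §2 Lemma 2.1 p. 8] [cite: Kottwitz1986, §3] -/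
theorem typeTwo_two_le_n_of_even_ram (he : v.asIdeal.ramificationIdx' w.1.asIdeal ≠ 1) (h2 : IsUnit (2 : 𝒪[(w.1.adicCompletion L)]))
    (ϖ : w.1.adicCompletion L) (hϖ : Valued.v ϖ = WithZero.exp (-1 : ℤ)) (hσϖ : galAdicCompletionMap (L := L) (IsCMField.complexConj L) hw ϖ = -ϖ)
    ⦃γH : ((cmDatum L 2 (Matrix.of fun i j : Fin 2 => if i.val + j.val + 1 = 2 then (1 : L) else 0)).Local v × (cmDatum L 1 (Matrix.of fun i j : Fin 1 => if i.val + j.val + 1 = 1 then (1 : L) else 0)).Local v)⦄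
    (hblk : ∀ i j : Fin 2, Valued.v (((((γH.1.val : GL (Fin 2) (UnitaryGroup.LocalRing L v)).val.map (Pi.evalRingHom (fun w' : PlacesOver L v => w'.1.adicCompletion L) w))) - 1) i j) ≤ Valued.v (ϖ ^ 2))
    (hirr : ¬ ∃ x : (w.1.adicCompletion L), (((((γH.1.val : GL (Fin 2) (UnitaryGroup.LocalRing L v)).val.map (Pi.evalRingHom (fun w' : PlacesOver L v => w'.1.adicCompletion L) w)))).charpoly).IsRoot x) ⦃n : ℕ⦄
    (hdisc : Valued.v (((((γH.1.val : GL (Fin 2) (UnitaryGroup.LocalRing L v)).val.map (Pi.evalRingHom (fun w' : PlacesOver L v => w'.1.adicCompletion L) w)))).trace ^ 2 - 4 * ((((γH.1.val : GL (Fin 2) (UnitaryGroup.LocalRing L v)).val.map (Pi.evalRingHom (fun w' : PlacesOver L v => w'.1.adicCompletion L) w)))).det) = WithZero.exp (-((2 * (2 * n) : ℕ) : ℤ))) (hn : 1 ≤ n) :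
    2 ≤ n := by
  by_contra hlt
  obtain rfl : n = 1 := by omega
  have h2v : Valued.v (2 : w.1.adicCompletion L) = 1 := (isUnit_two_integer_iff_valued_eq_one L w.1).1 h2
  have h20 : (2 : w.1.adicCompletion L) ≠ 0 := fun h => by rw [h, map_zero] at h2v; exact zero_ne_one h2v
  have hϖ0 : ϖ ≠ 0 := fun h => by rw [h, map_zero] at hϖ; exact WithZero.zero_ne_coe hϖ
  have hP0 : ϖ ^ 2 ≠ 0 := pow_ne_zero _ hϖ0
  have hϖ2lt : Valued.v (ϖ ^ 2) < 1 := by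
    rw [map_pow, hϖ, ← WithZero.exp_nsmul, ← WithZero.exp_zero]; exact WithZero.exp_lt_exp.2 (by norm_num)
  set ϖu : (w.1.adicCompletion L)ˣ := Units.mk0 ϖ hϖ0 with hϖudef
  have hϖu : (ϖu : (w.1.adicCompletion L)) = ϖ := rfl
  -- the one-place image `ĝ_w` IS the evaluated matrix (★ `coe_localNonsplitEquiv_apply` is `rfl`)
  have hΓ : ((((localNonsplitEquiv (IsCMField.complexConj L) (Matrix.of fun i j : Fin 2 => if i.val + j.val + 1 = 2 then (1 : L) else 0) (IsCMField.complexConj_ne_one L) w hw) γH.1 : ↥(unitaryGroupOfForm (galAdicCompletionMap (L := L) (IsCMField.complexConj L) hw) (placeForm (Matrix.of fun i j : Fin 2 => if i.val + j.val + 1 = 2 then (1 : L) else 0) w.1))) : GL (Fin 2) (w.1.adicCompletion L)) : Matrix (Fin 2) (Fin 2) (w.1.adicCompletion L)) = (((γH.1.val : GL (Fin 2) (UnitaryGroup.LocalRing L v)).val.map (Pi.evalRingHom (fun w' : PlacesOver L v => w'.1.adicCompletion L) w))) := rfl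
  have hblk' : ∀ i j : Fin 2, Valued.v ((((((localNonsplitEquiv (IsCMField.complexConj L) (Matrix.of fun i j : Fin 2 => if i.val + j.val + 1 = 2 then (1 : L) else 0) (IsCMField.complexConj_ne_one L) w hw) γH.1 : ↥(unitaryGroupOfForm (galAdicCompletionMap (L := L) (IsCMField.complexConj L) hw) (placeForm (Matrix.of fun i j : Fin 2 => if i.val + j.val + 1 = 2 then (1 : L) else 0) w.1))) : GL (Fin 2) (w.1.adicCompletion L)) : Matrix (Fin 2) (Fin 2) (w.1.adicCompletion L)) - 1) i j) ≤ Valued.v (ϖ ^ 2) := fun i j => by rw [hΓ]; exact hblk i j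
  -- `|½tr g_w − 1| ≤ |ϖ²|`
  have hcD : Valued.v (((((localNonsplitEquiv (IsCMField.complexConj L) (Matrix.of fun i j : Fin 2 => if i.val + j.val + 1 = 2 then (1 : L) else 0) (IsCMField.complexConj_ne_one L) w hw) γH.1 : ↥(unitaryGroupOfForm (galAdicCompletionMap (L := L) (IsCMField.complexConj L) hw) (placeForm (Matrix.of fun i j : Fin 2 => if i.val + j.val + 1 = 2 then (1 : L) else 0) w.1))) : GL (Fin 2) (w.1.adicCompletion L)) : Matrix (Fin 2) (Fin 2) (w.1.adicCompletion L)).trace / 2 - 1) ≤ Valued.v ((ϖu : (w.1.adicCompletion L)) ^ (2 * 1)) := by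
    rw [hϖu, mul_one]
    have e : ((((localNonsplitEquiv (IsCMField.complexConj L) (Matrix.of fun i j : Fin 2 => if i.val + j.val + 1 = 2 then (1 : L) else 0) (IsCMField.complexConj_ne_one L) w hw) γH.1 : ↥(unitaryGroupOfForm (galAdicCompletionMap (L := L) (IsCMField.complexConj L) hw) (placeForm (Matrix.of fun i j : Fin 2 => if i.val + j.val + 1 = 2 then (1 : L) else 0) w.1))) : GL (Fin 2) (w.1.adicCompletion L)) : Matrix (Fin 2) (Fin 2) (w.1.adicCompletion L)).trace / 2 - 1 = ((((((localNonsplitEquiv (IsCMField.complexConj L) (Matrix.of fun i j : Fin 2 => if i.val + j.val + 1 = 2 then (1 : L) else 0) (IsCMField.complexConj_ne_one L) w hw) γH.1 : ↥(unitaryGroupOfForm (galAdicCompletionMap (L := L) (IsCMField.complexConj L) hw) (placeForm (Matrix.of fun i j : Fin 2 => if i.val + j.val + 1 = 2 then (1 : L) else 0) w.1))) : GL (Fin 2) (w.1.adicCompletion L)) : Matrix (Fin 2) (Fin 2) (w.1.adicCompletion L)) - 1) 0 0 + (((((localNonsplitEquiv (IsCMField.complexConj L) (Matrix.of fun i j :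 Fin 2 => if i.val + j.val + 1 = 2 then (1 : L) else 0) (IsCMField.complexConj_ne_one L) w hw) γH.1 : ↥(unitaryGroupOfForm (galAdicCompletionMap (L := L) (IsCMField.complexConj L) hw) (placeForm (Matrix.of fun i j : Fin 2 => if i.val + j.val + 1 = 2 then (1 : L) else 0) w.1))) : GL (Fin 2) (w.1.adicCompletion L)) : Matrix (Fin 2) (Fin 2) (w.1.adicCompletion L)) - 1) 1 1) / 2 := by
      rw [Matrix.trace_fin_two, Matrix.sub_apply, Matrix.sub_apply, Matrix.one_apply_eq, Matrix.one_apply_eq]; field_simp; ring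
    rw [e, map_div₀, h2v, div_one]
    exact Valuation.map_add_le _ (hblk' 0 0) (hblk' 1 1)
  -- the level-`ϖ²` set of fixed self-dual W-lattices, in the ★ W-side currency
  set S : Set (Submodule (Valued.integer (w.1.adicCompletion L)) (Fin 2 → (w.1.adicCompletion L))) :=
    {B : Submodule (Valued.integer (w.1.adicCompletion L)) (Fin 2 → (w.1.adicCompletion L)) | IsSelfDualLattice (galAdicCompletionMap (L := L) (IsCMField.complexConj L) hw) (ϖu : (w.1.adicCompletion L)) (placeForm (Matrix.of fun i j : Fin 2 => if i.val + j.val + 1 = 2 then (1 : L) else 0) w.1) B ∧ mapGL (((localNonsplitEquiv (IsCMField.complexConj L) (Matrix.of fun i j : Fin 2 => if i.val + j.val + 1 = 2 then (1 : L) else 0) (IsCMField.complexConj_ne_one L) w hw) γH.1 : ↥(unitaryGroupOfForm (galAdicCompletionMap (L := L) (IsCMField.complexConj L) hw) (placeForm (Matrix.of fun i j : Fin 2 => if i.val + j.val + 1 = 2 then (1 : L) else 0) w.1))) : GL (Fin 2) (w.1.adicCompletion L)) B = B ∧ B.map ((Matrix.toLin' (((((localNonsplitEquiv (IsCMField.complexConj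 L) (Matrix.of fun i j : Fin 2 => if i.val + j.val + 1 = 2 then (1 : L) else 0) (IsCMField.complexConj_ne_one L) w hw) γH.1 : ↥(unitaryGroupOfForm (galAdicCompletionMap (L := L) (IsCMField.complexConj L) hw) (placeForm (Matrix.of fun i j : Fin 2 => if i.val + j.val + 1 = 2 then (1 : L) else 0) w.1))) : GL (Fin 2) (w.1.adicCompletion L)) : Matrix (Fin 2) (Fin 2) (w.1.adicCompletion L)) - 1)).restrictScalars (Valued.integer (w.1.adicCompletion L))) ≤ scaleLattice ((ϖu : (w.1.adicCompletion L)) ^ (2)) B} with hSdef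
  have hzero : S.ncard = 0 :=
    ncard_selfDual_fixed_lev_pow_eq_zero_of_le_of_even_depth_ramified L v w hw he h2 ϖu hϖ hσϖ γH.1 hirr (n := 1) hdisc le_rfl (D := 2) le_rfl hcD
  have hfin : S.Finite :=
    (finite_selfDual_fixed_of_even_depth_ramified L v w hw he h2 ϖu hϖ hσϖ γH.1 hirr (n := 1) hdisc le_rfl).subset fun B hB => ⟨hB.1, hB.2.1⟩
  have hempty : S = ∅ := (Set.ncard_eq_zero hfin).1 hzero
  -- but the root `L₀ = 𝒪_w²` lies in `S`
  have hmem : stdLattice (w.1.adicCompletion L) 2 ∈ S := by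
    refine ⟨?_, ?_, ?_⟩
    · rw [hϖu, placeForm_antidiagOne]
      exact isSelfDualLattice_stdLattice_two_of_v hϖ
    · exact mapGL_stdLattice_eq_of_forall_v_sub_one_lt_one (((localNonsplitEquiv (IsCMField.complexConj L) (Matrix.of fun i j : Fin 2 => if i.val + j.val + 1 = 2 then (1 : L) else 0) (IsCMField.complexConj_ne_one L) w hw) γH.1 : ↥(unitaryGroupOfForm (galAdicCompletionMap (L := L) (IsCMField.complexConj L) hw) (placeForm (Matrix.of fun i j : Fin 2 => if i.val + j.val + 1 = 2 then (1 : L) else 0) w.1))) : GL (Fin 2) (w.1.adicCompletion L)) (fun i k => lt_of_le_of_lt (hblk' i k) hϖ2lt)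
    · rw [hϖu]
      exact (map_sub_one_stdLattice_le_scaleLattice_iff hP0 (((localNonsplitEquiv (IsCMField.complexConj L) (Matrix.of fun i j : Fin 2 => if i.val + j.val + 1 = 2 then (1 : L) else 0) (IsCMField.complexConj_ne_one L) w hw) γH.1 : ↥(unitaryGroupOfForm (galAdicCompletionMap (L := L) (IsCMField.complexConj L) hw) (placeForm (Matrix.of fun i j : Fin 2 => if i.val + j.val + 1 = 2 then (1 : L) else 0) w.1))) : GL (Fin 2) (w.1.adicCompletion L))).2 hblk'
  rw [hempty] at hmem
  exact hmem

end EvenMin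

end Literature.NumberTheory.Rogawski1990

end
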